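import Literature.AlgebraicGeometry.Motives.AbelianVarietyWeights
import Literature.AlgebraicGeometry.Motives.StandardConjecturesKunnethProofs
import Literature.AlgebraicGeometry.Motives.CorrespondencesAlgebraicOperators
import Mathlib.LinearAlgebra.Multilinear.Curry
import Mathlib.LinearAlgebra.Alternating.Basic
import Mathlib.LinearAlgebra.Matrix.Determinant.Basic
import Mathlib.LinearAlgebra.ExteriorPower.Basis
import HarnessLib

/-!
# The exterior-algebra structure of `H•(A)` and the Fourier-type correspondences

For a Weil cohomology theory `W` (Kleiman, *Algebraic cycles and the Weil conjectures* (1968),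
§1.2) and an abelian variety `A`, smooth projective of dimension `g`, carrying a degree-two class
`η` with `ηᵍ ≠ 0` (any hyperplane class), this file derives from the bialgebra structure of
`H•(A)` (`Motives/AbelianVarietyHopf`) and the weight/generation theorems
(`Motives/AbelianVarietyWeights`) the structure theorem `H•(A) = Λ• H¹(A)`, `dim H¹(A) = 2g`
(Kleiman 1968, Appendix 2A; Mumford, *Abelian Varieties* §1, §15 for the classical theories), in
the following concrete form, and the algebraic isomorphisms `H²ᵍ⁻ⁱ(A) ⥲ Hⁱ(A)` used in the
Lieberman–Kleiman theorem `B(A)` (`Motives/StandardConjecturesAbelianVarietyProofs`):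

* `contrOne`: the contractions `D_φ = (φ ⊗ id) ∘ Δ_{1,c}` against linear forms `φ` on `H¹(A)`
  are graded derivations (`contrOne_cup`, `contrOne_cup_deg_two`);
* `prodAlt`: the iterated cup product `m_d : H¹(A)^d → Hᵈ(A)` is alternating; the Leibniz rule
  `D_φ(m_{d+1}(v)) = Σ_p (-1)ᵖ φ(v_p) m_d(v ∘ p.succAbove)` (`contrOne_prodMap`) and the
  **determinant formula** `C_φ(m_d(v)) = det(φᵢ(vⱼ))` for the iterated contraction
  (`iterContr_prodMap`, Laplace expansion);
* `prodBasis`: for any basis `b` of `H¹(A)`, the ordered products `m_d(b_{s₁}, …, b_{s_d})`,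
  `s` running over the `d`-element subsets, form a basis of `Hᵈ(A)` (independence by the dual
  family of iterated contractions, spanning through `Λᵈ H¹(A)` and generation by `H¹`); hence
  `dim Hᵈ(A) = (dim H¹ choose d)` (`finrank_eq_choose`) and **`dim H¹(A) = 2g`**
  (`eq_two_mul_dim`);
* `polarization`, `polBasis`: the map `φ ↦ D_φ(η)` is injective (`D_φ(ηᵍ) = g D_φ(η) ∪ ηᵍ⁻¹` and
  `D_φ` is injective on the top degree), giving the polarization basis `y_a = D_{b*_a}(η)` with
  `Δ_{1,1} η = Σ_a b_a ⊗ y_a` (`coprod_one_one_eq_sum`);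
* `polClass`: the polarization class `ℓ = ext(Δ_{1,1} η) = m*η - pr₁*η - pr₂*η ∈ A¹(A × A)_ℚ`
  (cohomological first Chern class of the Mumford bundle) and the expansion
  `ℓⁱ = sᵢ Σ_c pr₁* m_i(b ∘ c) ∪ pr₂* m_i(y ∘ c)` (`pow_polClass_eq_sum`, `sᵢ = ±1`);
* `fourierOp`: the operator `F(z) = Σ_c tr(z ∪ m_i(b ∘ c)) m_i(y ∘ c) : Hʲ(A) → Hⁱ(A)`,
  `j + i = 2g`, is induced by the rational algebraic class `sᵢ ℓⁱ`
  (`isAlgebraicOperator_fourierOp`) and is **bijective** (`fourierOp_bijective`: regrouping the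
  alternating sum by images of tuples, the two bases, Poincaré duality).

Everything is formal in the axioms of `WeilCohomology`; no named facts are introduced.

## References

* S. Kleiman, *Algebraic cycles and the Weil conjectures*, in: Dix exposés sur la cohomologie
  des schémas, North-Holland (1968), 359–386, Appendix 2A (2A8–2A11). [Kleiman1968AlgebraicCycles]
* D. Lieberman, *Numerical and homological equivalence of algebraic cycles on Hodge manifolds*,
  Amer. J. Math. 90 (1968), 366–374.
* D. Mumford, *Abelian Varieties*, TIFR Studies in Math. 5, OUP (1970), §1, §6, §15, §16.
  [MumfordAV1970]
-/

universe u v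

open CategoryTheory AlgebraicGeometry MonoidalCategory CartesianMonoidalCategory Opposite
open scoped TensorProduct DirectSum

noncomputable section

namespace Literature.AlgebraicGeometry.Motives

namespace WeilCohomology

variable {k : Type u} [Field k] {K : Type v} [Field K] [CharZero K] (W : WeilCohomology k K)

/-! ## The exterior-algebra structure: alternating products of degree-one classes -/

section Exterior

open scoped MonObj

variable {g : ℕ} (A : AbelianVariety k)

/-! ### Two more shift lemmas (vanishing, left multiplication) -/

omit [CharZero K] in
/-- Shift lemma (left, second factor), vanishing part: the `(a, b')` Künneth components of
`pr₂* w ∪ u` with `b' < deg w` vanish. [folklore] -/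
lemma kunnethComponent_pullback_snd_cup_eq_zero' {n m : ℕ} {X Y : SchemeOver k} [CharZero K]
    (W : WeilCohomology k K)
    (hX : IsSmoothProjective n X) (hY : IsSmoothProjective m Y) {p e f : ℕ} (h : e + p = f)
    (w : W.obj Y e) (u : W.obj (X ⊗ Y) p) {a b' : ℕ} (h' : a + b' = f) (hb : b' < e) :
    W.kunnethComponent hX hY a b' h' (W.cup h (W.pullback (snd X Y) e w) u) = 0 := by
  induction u using W.kunneth_induction hX hY with
  | zero => simp
  | add u u' hu hu' => simp only [map_add, hu, hu', add_zero]
  | ext i j hij x y =>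
    rw [← extTensor_tmul, W.cup_pullback_snd_extTensor hX hY hij h (rfl : e + j = e + j)
      (by omega) w (x ⊗ₜ y), map_zsmul, W.kunnethComponent_extTensor_of_ne hX hY h' _, smul_zero]
    intro hc
    obtain ⟨-, h2⟩ := Prod.mk.inj hc
    omega

/-! ### Degree-one contractions (derivations) -/

/-- The **degree-one contraction** `D_φ = (φ ⊗ id) ∘ Δ_{1,c} : Hᵈ(A) → Hᶜ(A)` (`1 + c = d`)
against a linear form `φ` on `H¹(A)`; it is a graded derivation (`contrOne_cup`). [folklore] -/
def contrOne (hA : IsSmoothProjective g A.X) (φ : Module.Dual K (W.obj A.X 1)) {c d : ℕ}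
    (h : 1 + c = d) : W.obj A.X d →ₗ[K] W.obj A.X c :=
  (TensorProduct.lid K (W.obj A.X c)).toLinearMap ∘ₗ LinearMap.rTensor (W.obj A.X c) φ ∘ₗ
    W.coprod A hA 1 c h

/-- `D_φ` unfolded. [folklore] -/
lemma contrOne_apply (hA : IsSmoothProjective g A.X) (φ : Module.Dual K (W.obj A.X 1)) {c d : ℕ}
    (h : 1 + c = d) (x : W.obj A.X d) :
    W.contrOne A hA φ h x =
      TensorProduct.lid K (W.obj A.X c) (LinearMap.rTensor (W.obj A.X c) φ (W.coprod A hA 1 c h x)) :=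
  rfl

/-- `D_φ` is linear in `φ`. [folklore] -/
lemma contrOne_add (hA : IsSmoothProjective g A.X) (φ ψ : Module.Dual K (W.obj A.X 1)) {c d : ℕ}
    (h : 1 + c = d) : W.contrOne A hA (φ + ψ) h = W.contrOne A hA φ h + W.contrOne A hA ψ h := by
  ext x
  simp [contrOne_apply, LinearMap.rTensor_add]

/-- `D_φ` is homogeneous in `φ`. [folklore] -/
lemma contrOne_smul (hA : IsSmoothProjective g A.X) (c₀ : K) (φ : Module.Dual K (W.obj A.X 1))
    {c d : ℕ} (h : 1 + c = d) : W.contrOne A hA (c₀ • φ) h = c₀ • W.contrOne A hA φ h := by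
  ext x
  simp [contrOne_apply, LinearMap.rTensor_smul]

/-- Naturality: `(φ ⊗ id)` followed by the unitor commutes with `id ⊗ f`. [folklore] -/
lemma lid_rTensor_lTensor {M N : Type*} [AddCommGroup M] [Module K M] [AddCommGroup N] [Module K N]
    (φ : Module.Dual K (W.obj A.X 1)) (f : M →ₗ[K] N) (t : W.obj A.X 1 ⊗[K] M) :
    TensorProduct.lid K N (LinearMap.rTensor N φ (LinearMap.lTensor (W.obj A.X 1) f t)) =
      f (TensorProduct.lid K M (LinearMap.rTensor M φ t)) := by
  induction t using TensorProduct.induction_on with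
  | zero => simp
  | tmul a b => simp
  | add t t' ht ht' => simp only [map_add, ht, ht']

/-- `D_φ` on a class of degree one: `D_φ v = φ(v) · 1`. [folklore] -/
lemma contrOne_deg_one (hA : IsSmoothProjective g A.X) (φ : Module.Dual K (W.obj A.X 1))
    (v : W.obj A.X 1) : W.contrOne A hA φ (Nat.add_zero 1) v = φ v • W.one A.X := by
  rw [contrOne_apply, W.coprod_self_zero A hA v, LinearMap.rTensor_tmul, TensorProduct.lid_tmul]

/-- **Leibniz rule, degree zero**: for `v ∈ H¹(A)` and `x ∈ H⁰(A)`, `D_φ(v ∪ x) = φ(v) x`.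
[folklore] -/
lemma contrOne_cup_deg_zero (hA : IsSmoothProjective g A.X) (φ : Module.Dual K (W.obj A.X 1))
    (v : W.obj A.X 1) (x : W.obj A.X 0) :
    W.contrOne A hA φ (Nat.add_zero 1) (W.cup (Nat.add_zero 1) v x) = φ v • x := by
  obtain ⟨c, rfl⟩ := W.exists_eq_smul_one hA x
  rw [LinearMap.map_smul, W.cup_one hA, map_smul, W.contrOne_deg_one A hA, smul_comm]

/-- **Leibniz rule** for the contraction against a degree-one class on the left:
`D_φ(v ∪ x) = φ(v) x - v ∪ D_φ(x)` for `v ∈ H¹(A)`, `x ∈ Hᵈ(A)`, `d = 1 + c` (degree-one classes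
are primitive, and `pr₂* v` anticommutes with the first tensor factor `H¹`). [cite: MumfordAV1970, §1] -/
theorem contrOne_cup (hA : IsSmoothProjective g A.X) (φ : Module.Dual K (W.obj A.X 1)) {c d e : ℕ}
    (h : 1 + c = d) (h' : 1 + d = e) (v : W.obj A.X 1) (x : W.obj A.X d) :
    W.contrOne A hA φ h' (W.cup h' v x) = φ v • x - W.cup h v (W.contrOne A hA φ h x) := by
  have hAA := IsSmoothProjective.tensor_holds hA hA
  rw [contrOne_apply, coprod_apply, W.map_cup hAA hA μ[A.X] h' v x, W.pullback_mu_of_deg_one A hA v,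
    LinearMap.map_add₂, map_add,
    W.kunnethComponent_pullback_fst_cup hA hA h' v _ (Nat.zero_add d) (Nat.add_zero 1) h',
    W.kunnethComponent_pullback_snd_cup hA hA h' v _ h h h', ← coprod_apply, ← coprod_apply,
    W.coprod_zero_self A hA x, LinearMap.rTensor_tmul, W.cup_one hA, map_add, map_add,
    LinearMap.rTensor_tmul, TensorProduct.lid_tmul, map_zsmul, map_zsmul, W.lid_rTensor_lTensor A,
    ← contrOne_apply]
  simp only [Nat.cast_one, mul_one, Int.negOnePow_one, Units.val_neg, Units.val_one, neg_smul,
    one_smul]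
  abel

/-! ### The alternating product `m_d : H¹(A)^d → Hᵈ(A)` -/

/-- Left multiplication by a degree-one class composed with a multilinear map, linearly in the
class. [folklore] -/
def consProd (d : ℕ) (f : MultilinearMap K (fun _ : Fin d ↦ W.obj A.X 1) (W.obj A.X d)) :
    W.obj A.X 1 →ₗ[K] MultilinearMap K (fun _ : Fin d ↦ W.obj A.X 1) (W.obj A.X (d + 1)) where
  toFun v := (W.cup (Nat.add_comm 1 d) v).compMultilinearMap f
  map_add' v w := by ext u; simp
  map_smul' c v := by ext u; simp

/-- The **iterated cup product** `m_d(v₀, …, v_{d-1}) = v₀ ∪ (v₁ ∪ (⋯ ∪ (v_{d-1} ∪ 1)))` of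
degree-one classes, as a multilinear map `H¹(A)^d → Hᵈ(A)`. [folklore] -/
def prodMap : (d : ℕ) → MultilinearMap K (fun _ : Fin d ↦ W.obj A.X 1) (W.obj A.X d)
  | 0 => MultilinearMap.constOfIsEmpty K _ (W.one A.X)
  | d + 1 => LinearMap.uncurryLeft (W.consProd A d (prodMap d))

/-- `m₀ = 1`. [folklore] -/
@[simp]
lemma prodMap_zero (v : Fin 0 → W.obj A.X 1) : W.prodMap A 0 v = W.one A.X := rfl

/-- `m_{d+1}(v) = v₀ ∪ m_d(tail v)`. [folklore] -/
lemma prodMap_succ (d : ℕ) (v : Fin (d + 1) → W.obj A.X 1) :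
    W.prodMap A (d + 1) v = W.cup (Nat.add_comm 1 d) (v 0) (W.prodMap A d (Fin.tail v)) := rfl

/-- A degree-one class squares to zero (graded commutativity, characteristic zero). [folklore] -/
lemma cup_self_deg_one (hA : IsSmoothProjective g A.X) (v : W.obj A.X 1) :
    W.cup (rfl : 1 + 1 = 2) v v = 0 := by
  have h := W.cup_comm hA (rfl : 1 + 1 = 2) rfl v v
  simp only [Nat.cast_one, mul_one, Int.negOnePow_one, Units.val_neg, Units.val_one, neg_smul,
    one_smul] at h
  have h2 : (2 : K) • W.cup (rfl : 1 + 1 = 2) v v = 0 := by rw [two_smul]; nth_rw 1 [h]; simp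
  exact (smul_eq_zero.mp h2).resolve_left two_ne_zero

/-- A degree-one class occurring among the factors kills the product when multiplied on the left:
`w ∪ m_d(u) = 0` if `w = u p` for some `p`. [folklore] -/
lemma cup_prodMap_eq_zero_of_eq (hA : IsSmoothProjective g A.X) (d : ℕ) (u : Fin d → W.obj A.X 1)
    (p : Fin d) :
    W.cup (Nat.add_comm 1 d) (u p) (W.prodMap A d u) = 0 := by
  induction d with
  | zero => exact p.elim0
  | succ d ih =>
    rw [prodMap_succ]
    cases p using Fin.cases with
    | zero =>
      rw [← W.cup_assoc hA (rfl : 1 + 1 = 2) (Nat.add_comm 1 d) (by omega) (Nat.add_comm 1 (d + 1)),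
        W.cup_self_deg_one A hA, LinearMap.map_zero₂]
    | succ q =>
      rw [← W.cup_assoc hA (rfl : 1 + 1 = 2) (Nat.add_comm 1 d) (by omega) (Nat.add_comm 1 (d + 1)),
        W.cup_comm hA (rfl : 1 + 1 = 2) rfl (u q.succ) (u 0)]
      simp only [Nat.cast_one, mul_one, Int.negOnePow_one, Units.val_neg, Units.val_one, neg_smul,
        one_smul, LinearMap.map_neg₂, neg_eq_zero]
      rw [W.cup_assoc hA (rfl : 1 + 1 = 2) (Nat.add_comm 1 d) (by omega) (Nat.add_comm 1 (d + 1))]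
      change W.cup _ (u 0) (W.cup (Nat.add_comm 1 d) (Fin.tail u q) (W.prodMap A d (Fin.tail u))) = 0
      rw [ih (Fin.tail u) q, LinearMap.map_zero]

/-- The iterated cup product of degree-one classes is alternating. [folklore] -/
lemma prodMap_eq_zero_of_eq (hA : IsSmoothProjective g A.X) (d : ℕ) (v : Fin d → W.obj A.X 1)
    (i j : Fin d) (hv : v i = v j) (hij : i ≠ j) : W.prodMap A d v = 0 := by
  induction d with
  | zero => exact i.elim0
  | succ d ih =>
    rw [prodMap_succ]
    -- one of `i`, `j` is `0`, or both are successors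
    cases i using Fin.cases with
    | zero =>
      cases j using Fin.cases with
      | zero => exact absurd rfl hij
      | succ j' =>
        rw [hv]
        exact W.cup_prodMap_eq_zero_of_eq A hA d (Fin.tail v) j'
    | succ i' =>
      cases j using Fin.cases with
      | zero =>
        rw [← hv]
        exact W.cup_prodMap_eq_zero_of_eq A hA d (Fin.tail v) i'
      | succ j' =>
        have : W.prodMap A d (Fin.tail v) = 0 :=
          ih (Fin.tail v) i' j' hv fun e ↦ hij (by rw [e])
        rw [this, LinearMap.map_zero]

/-- The **alternating product** `m_d : H¹(A)^d → Hᵈ(A)` of degree-one classes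
(`H•(A)` receives `Λ• H¹(A)`; Kleiman 1968, 2A). [cite: Kleiman1968AlgebraicCycles, Appendix 2A] -/
def prodAlt (hA : IsSmoothProjective g A.X) (d : ℕ) : W.obj A.X 1 [⋀^Fin d]→ₗ[K] W.obj A.X d :=
  { W.prodMap A d with
    map_eq_zero_of_eq' := fun v i j hv hij ↦ W.prodMap_eq_zero_of_eq A hA d v i j hv hij }

/-- `prodAlt` is `prodMap` as a function. [folklore] -/
@[simp]
lemma prodAlt_apply (hA : IsSmoothProjective g A.X) (d : ℕ) (v : Fin d → W.obj A.X 1) :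
    W.prodAlt A hA d v = W.prodMap A d v := rfl

/-! ### Leibniz rule on alternating products and the determinant formula -/

/-- **Leibniz rule on an alternating product**:
`D_φ(m_{d+1}(v)) = Σ_p (-1)^p φ(v_p) m_d(v ∘ p.succAbove)`. [cite: MumfordAV1970, §1] -/
theorem contrOne_prodMap (hA : IsSmoothProjective g A.X) (φ : Module.Dual K (W.obj A.X 1)) (d : ℕ)
    (v : Fin (d + 1) → W.obj A.X 1) :
    W.contrOne A hA φ (Nat.add_comm 1 d) (W.prodMap A (d + 1) v) =
      ∑ p : Fin (d + 1), ((-1 : K) ^ (p : ℕ) * φ (v p)) • W.prodMap A d (fun i ↦ v (p.succAbove i)) := by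
  induction d with
  | zero =>
    rw [prodMap_succ, prodMap_zero, Fin.sum_univ_one, W.contrOne_cup_deg_zero A hA]
    simp
  | succ d ih =>
    rw [prodMap_succ, W.contrOne_cup A hA φ (Nat.add_comm 1 d) (Nat.add_comm 1 (d + 1)), ih]
    conv_rhs => rw [Fin.sum_univ_succ]
    simp only [Fin.val_zero, pow_zero, one_mul, Fin.zero_succAbove, Fin.val_succ, map_sum,
      LinearMap.map_smul, sub_eq_add_neg, ← Finset.sum_neg_distrib]
    congr 1
    refine Finset.sum_congr rfl fun q _ ↦ ?_
    rw [prodMap_succ]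
    simp only [Fin.succ_succAbove_zero, Fin.tail, ← neg_smul, pow_succ]
    congr 1
    · ring
    · congr 2
      funext i
      exact congrArg v (Fin.succ_succAbove_succ q i).symm

/-- The coordinate `ε : H⁰(A) → K`, `c • 1 ↦ c` (`H⁰(A) = K · 1`). [folklore] -/
def counit (hA : IsSmoothProjective g A.X) : W.obj A.X 0 →ₗ[K] K :=
  (LinearEquiv.ofBijective (LinearMap.toSpanSingleton K (W.obj A.X 0) (W.one A.X))
    ⟨fun a b hab ↦ smul_left_injective K (W.unit_ne_zero hA) hab,
      fun x ↦ by obtain ⟨c, rfl⟩ := W.exists_eq_smul_one hA x; exact ⟨c, rfl⟩⟩).symm.toLinearMap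

/-- `ε(c • 1) = c`. [folklore] -/
@[simp]
lemma counit_smul_one (hA : IsSmoothProjective g A.X) (c : K) : W.counit A hA (c • W.one A.X) = c := by
  rw [counit, LinearEquiv.coe_toLinearMap, LinearEquiv.symm_apply_eq]
  rfl

/-- `ε(1) = 1`. [folklore] -/
@[simp]
lemma counit_one (hA : IsSmoothProjective g A.X) : W.counit A hA (W.one A.X) = 1 := by
  simpa using W.counit_smul_one A hA 1

/-- The **iterated contraction** `C_φ = ε ∘ D_{φ_{d-1}}-⋯ ∘ D_{φ₀}`, precisely
`C_{φ} = C_{tail φ} ∘ D_{φ₀} : Hᵈ(A) → K` for `φ : Fin d → H¹(A)ᵛ`. [folklore] -/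
def iterContr (hA : IsSmoothProjective g A.X) :
    (d : ℕ) → (Fin d → Module.Dual K (W.obj A.X 1)) → (W.obj A.X d →ₗ[K] K)
  | 0, _ => W.counit A hA
  | d + 1, φ => iterContr hA d (Fin.tail φ) ∘ₗ W.contrOne A hA (φ 0) (Nat.add_comm 1 d)

/-- **Determinant formula**: `C_φ(m_d(v)) = det (φᵢ(vⱼ))` (Laplace expansion along the first
row matches the Leibniz rule). [folklore] -/
theorem iterContr_prodMap (hA : IsSmoothProjective g A.X) (d : ℕ)
    (φ : Fin d → Module.Dual K (W.obj A.X 1)) (v : Fin d → W.obj A.X 1) :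
    W.iterContr A hA d φ (W.prodMap A d v) = (Matrix.of fun i j ↦ φ i (v j)).det := by
  induction d with
  | zero => simp [iterContr, Matrix.det_isEmpty]
  | succ d ih =>
    rw [iterContr, LinearMap.comp_apply, W.contrOne_prodMap A hA, map_sum,
      Matrix.det_succ_row_zero]
    refine Finset.sum_congr rfl fun p _ ↦ ?_
    rw [LinearMap.map_smul, ih, smul_eq_mul]
    have hM : (Matrix.of fun i j ↦ φ i (v j)).submatrix Fin.succ p.succAbove =
        Matrix.of fun i j ↦ Fin.tail φ i (v (p.succAbove j)) := rfl
    rw [hM, Matrix.of_apply]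

/-! ### Bases of `Hᵈ(A)` by ordered products of a basis of `H¹(A)` -/

open Set.powersetCard in
/-- The family `x_s = m_d(b_{s₁}, …, b_{s_d})` (`s₁ < ⋯ < s_d` the elements of `s`) of ordered
products of the vectors of a basis `b` of `H¹(A)`, indexed by the `d`-element subsets `s`.
[folklore] -/
def prodFamily {vd : ℕ} (b : Module.Basis (Fin vd) K (W.obj A.X 1)) (d : ℕ)
    (s : Set.powersetCard (Fin vd) d) : W.obj A.X d :=
  W.prodMap A d (b ∘ (ofFinEmbEquiv.symm s))

open Set.powersetCard in
/-- The dual family: iterated contractions against the coordinate forms `b*_{s₁}, …, b*_{s_d}`.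
[folklore] -/
def prodDual (hA : IsSmoothProjective g A.X) {vd : ℕ} (b : Module.Basis (Fin vd) K (W.obj A.X 1))
    (d : ℕ) (s : Set.powersetCard (Fin vd) d) : Module.Dual K (W.obj A.X d) :=
  W.iterContr A hA d (b.coord ∘ (ofFinEmbEquiv.symm s))

open Set.powersetCard in
/-- **Duality of the two families**: `C_s(x_t) = [s = t]` (the determinant of the `0/1`-matrix
`[sᵢ = tⱼ]`, as in Mathlib's `exteriorPower.ιMultiDual_apply_diag/nondiag`). [folklore] -/
theorem prodDual_prodFamily (hA : IsSmoothProjective g A.X) {vd : ℕ}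
    (b : Module.Basis (Fin vd) K (W.obj A.X 1)) (d : ℕ) (s t : Set.powersetCard (Fin vd) d) :
    W.prodDual A hA b d s (W.prodFamily A b d t) = if s = t then 1 else 0 := by
  classical
  rw [prodDual, prodFamily, W.iterContr_prodMap A hA]
  have hentry : (Matrix.of fun i j ↦ (b.coord ∘ (ofFinEmbEquiv.symm s)) i
      ((b ∘ (ofFinEmbEquiv.symm t)) j)) =
      Matrix.of fun i j ↦ if (ofFinEmbEquiv.symm t) j = (ofFinEmbEquiv.symm s) i then (1 : K) else 0 := by
    ext i j
    simp [Finsupp.single_apply]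
  rw [hentry]
  split_ifs with hst
  · subst hst
    have : (Matrix.of fun i j ↦ if (ofFinEmbEquiv.symm s) j = (ofFinEmbEquiv.symm s) i then
        (1 : K) else 0) = 1 := by
      ext i j
      simp only [Matrix.of_apply, Matrix.one_apply, EmbeddingLike.apply_eq_iff_eq, eq_comm]
    rw [this, Matrix.det_one]
  · obtain ⟨a, has, hat⟩ := (exists_mem_notMem_iff_ne s t).mp hst
    obtain ⟨i₀, rfl⟩ := (mem_range_ofFinEmbEquiv_symm_iff_mem s a).mpr has
    apply Matrix.det_eq_zero_of_row_eq_zero i₀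
    intro j
    simp only [Matrix.of_apply, ite_eq_right_iff, one_ne_zero, imp_false]
    intro hj
    apply hat
    rw [← hj]
    exact (mem_range_ofFinEmbEquiv_symm_iff_mem t _).mp ⟨j, rfl⟩

/-- **The ordered products of basis vectors are linearly independent** in `Hᵈ(A)`. [folklore] -/
theorem linearIndependent_prodFamily (hA : IsSmoothProjective g A.X) {vd : ℕ}
    (b : Module.Basis (Fin vd) K (W.obj A.X 1)) (d : ℕ) :
    LinearIndependent K (W.prodFamily A b d) :=
  LinearIndependent.of_pairwise_dual_eq_zero_one _ (W.prodDual A hA b d)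
    (fun s t hst ↦ by simp only [W.prodDual_prodFamily A hA, if_neg hst])
    (fun s ↦ by rw [W.prodDual_prodFamily A hA, if_pos rfl])

/-- `v ∪ m_d(u) = m_{d+1}(v, u)`. [folklore] -/
lemma cup_prodMap (d : ℕ) (v : W.obj A.X 1) (u : Fin d → W.obj A.X 1) :
    W.cup (Nat.add_comm 1 d) v (W.prodMap A d u) = W.prodMap A (d + 1) (Fin.cons v u) := by
  rw [prodMap_succ, Fin.cons_zero, Fin.tail_cons]

/-- **`Hᵈ(A)` is spanned by the products `m_d(v)`** (generation by `H¹(A)`, given a degree-two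
class `w` with `wᵍ ≠ 0`). [cite: Kleiman1968AlgebraicCycles, Appendix 2A] -/
theorem span_range_prodMap (hA : IsSmoothProjective g A.X) {w : W.obj A.X 2} (hw : W.pow A.X w g ≠ 0)
    (d : ℕ) : Submodule.span K (Set.range (W.prodMap A d)) = ⊤ := by
  induction d with
  | zero =>
    rw [eq_top_iff]
    rintro x -
    obtain ⟨c, rfl⟩ := W.exists_eq_smul_one hA x
    exact Submodule.smul_mem _ c (Submodule.subset_span ⟨Fin.elim0, rfl⟩)
  | succ d ih =>
    rw [eq_top_iff]
    rintro y -
    have hy : y ∈ LinearMap.range (W.mulOne A d) := by rw [W.range_mulOne A hA hw d]; trivial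
    obtain ⟨t, rfl⟩ := hy
    induction t using TensorProduct.induction_on with
    | zero => rw [map_zero]; exact zero_mem _
    | tmul v z =>
      rw [mulOne_tmul]
      have hz : z ∈ Submodule.span K (Set.range (W.prodMap A d)) := by rw [ih]; trivial
      have hle : Submodule.span K (Set.range (W.prodMap A d)) ≤
          (Submodule.span K (Set.range (W.prodMap A (d + 1)))).comap (W.cup (Nat.add_comm 1 d) v) := by
        rw [Submodule.span_le]
        rintro _ ⟨u, rfl⟩
        rw [SetLike.mem_coe, Submodule.mem_comap, W.cup_prodMap A d v u]
        exact Submodule.subset_span ⟨_, rfl⟩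
      exact hle hz
    | add t t' ht ht' => rw [map_add]; exact add_mem ht ht'

open Set.powersetCard in
/-- **The ordered products of basis vectors span `Hᵈ(A)`** (through the exterior power: the
alternating product factors over `Λᵈ H¹(A)`, which is spanned by ordered products of basis
vectors). [folklore] -/
theorem span_range_prodFamily (hA : IsSmoothProjective g A.X) {w : W.obj A.X 2}
    (hw : W.pow A.X w g ≠ 0) {vd : ℕ} (b : Module.Basis (Fin vd) K (W.obj A.X 1)) (d : ℕ) :
    Submodule.span K (Set.range (W.prodFamily A b d)) = ⊤ := by
  let F : ⋀[K]^d (W.obj A.X 1) →ₗ[K] W.obj A.X d :=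
    exteriorPower.alternatingMapLinearEquiv (W.prodAlt A hA d)
  have hF : ∀ v : Fin d → W.obj A.X 1, F (exteriorPower.ιMulti K d v) = W.prodMap A d v := fun v ↦
    exteriorPower.alternatingMapLinearEquiv_apply_ιMulti _ v
  have hrange : LinearMap.range F = Submodule.span K (Set.range (W.prodFamily A b d)) := by
    rw [LinearMap.range_eq_map, ← exteriorPower.ιMulti_family_span_of_span K b.span_eq,
      Submodule.map_span, ← Set.range_comp]
    congr 2
    funext s
    exact hF _
  rw [← hrange, eq_top_iff, ← W.span_range_prodMap A hA hw d, Submodule.span_le]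
  rintro _ ⟨v, rfl⟩
  exact ⟨exteriorPower.ιMulti K d v, hF v⟩

/-- **The basis of `Hᵈ(A)` by ordered products** of the vectors of a basis `b` of `H¹(A)`
(`Hᵈ(A) ≅ Λᵈ H¹(A)`; Kleiman 1968, 2A). [cite: Kleiman1968AlgebraicCycles, Appendix 2A] -/
def prodBasis (hA : IsSmoothProjective g A.X) {w : W.obj A.X 2} (hw : W.pow A.X w g ≠ 0) {vd : ℕ}
    (b : Module.Basis (Fin vd) K (W.obj A.X 1)) (d : ℕ) :
    Module.Basis (Set.powersetCard (Fin vd) d) K (W.obj A.X d) :=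
  Module.Basis.mk (W.linearIndependent_prodFamily A hA b d) (by rw [W.span_range_prodFamily A hA hw b d])

/-- The basis vectors are the ordered products. [folklore] -/
@[simp]
lemma prodBasis_apply (hA : IsSmoothProjective g A.X) {w : W.obj A.X 2} (hw : W.pow A.X w g ≠ 0)
    {vd : ℕ} (b : Module.Basis (Fin vd) K (W.obj A.X 1)) (d : ℕ) (s : Set.powersetCard (Fin vd) d) :
    W.prodBasis A hA hw b d s = W.prodFamily A b d s := by
  simp [prodBasis]

/-- **Betti numbers of an abelian variety**: `dim Hᵈ(A) = (dim H¹(A) choose d)`.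
[cite: Kleiman1968AlgebraicCycles, Appendix 2A] -/
theorem finrank_eq_choose (hA : IsSmoothProjective g A.X) {w : W.obj A.X 2} (hw : W.pow A.X w g ≠ 0)
    {vd : ℕ} (b : Module.Basis (Fin vd) K (W.obj A.X 1)) (d : ℕ) :
    Module.finrank K (W.obj A.X d) = vd.choose d := by
  rw [Module.finrank_eq_card_basis (W.prodBasis A hA hw b d), ← Nat.card_eq_fintype_card,
    Set.powersetCard.card, Nat.card_eq_fintype_card, Fintype.card_fin]

/-- **`dim H¹(A) = 2 dim A`** for any Weil cohomology theory: a basis of `H¹(A)` has `2g`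
elements (`dim H²ᵍ(A) = 1 = (dim H¹ choose 2g)` and `dim H²ᵍ⁺¹(A) = 0 = (dim H¹ choose 2g+1)`).
[cite: Kleiman1968AlgebraicCycles, Appendix 2A] -/
theorem eq_two_mul_dim (hA : IsSmoothProjective g A.X) {w : W.obj A.X 2} (hw : W.pow A.X w g ≠ 0)
    {vd : ℕ} (b : Module.Basis (Fin vd) K (W.obj A.X 1)) : vd = 2 * g := by
  have h1 := W.finrank_eq_choose A hA hw b (2 * g)
  rw [W.finrank_obj_two_mul hA] at h1
  have h2 := W.finrank_eq_choose A hA hw b (2 * g + 1)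
  rw [W.finrank_obj_eq_zero hA (by omega)] at h2
  have h3 : vd < 2 * g + 1 := Nat.choose_eq_zero_iff.mp h2.symm
  by_contra hne
  have h4 : vd < 2 * g := by omega
  rw [Nat.choose_eq_zero_of_lt h4] at h1
  exact one_ne_zero h1

/-! ### Contraction of a degree-two class: the polarization basis -/

omit [CharZero K] in
/-- Transport of a degree identity through an iterated cup product: the two ways of typing
`x ∪ (y ∪ z)` along propositionally equal middle degrees agree. [folklore] -/
lemma cup_congr_right {V : SchemeOver k} [CharZero K] (W : WeilCohomology k K) {a b m m' l N : ℕ}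
    (h₁ : a + b = m) (h₁' : a + b = m') (h₂ : l + m = N) (h₂' : l + m' = N) (x : W.obj V l)
    (y : W.obj V a) (z : W.obj V b) :
    W.cup h₂ x (W.cup h₁ y z) = W.cup h₂' x (W.cup h₁' y z) := by
  subst h₁
  subst h₁'
  rfl

/-- **Leibniz rule for left multiplication by a degree-two class**: for `z ∈ H²(A)` and
`y ∈ Hᵉ(A)` with `e = 1 + c`, `D_φ(z ∪ y) = D_φ(z) ∪ y + z ∪ D_φ(y)` (`H² = H¹ · H¹` and the
degree-one Leibniz rule twice). [cite: MumfordAV1970, §1] -/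
theorem contrOne_cup_deg_two (hA : IsSmoothProjective g A.X) (φ : Module.Dual K (W.obj A.X 1))
    {c e : ℕ} (hc : 1 + c = e) (z : W.obj A.X 2) (y : W.obj A.X e) :
    W.contrOne A hA φ (show 1 + (e + 1) = e + 2 by omega) (W.cup (show 2 + e = e + 2 by omega) z y) =
      W.cup (show 1 + e = e + 1 by omega) (W.contrOne A hA φ (rfl : 1 + 1 = 2) z) y +
        W.cup (show 2 + c = e + 1 by omega) z (W.contrOne A hA φ hc y) := by
  have hz : z ∈ LinearMap.range (W.mulOneOne A) := by rw [W.range_mulOneOne A hA]; trivial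
  obtain ⟨t, rfl⟩ := hz
  induction t using TensorProduct.induction_on with
  | zero => simp
  | tmul a b =>
    rw [mulOneOne_tmul,
      W.cup_assoc hA (rfl : 1 + 1 = 2) (show 1 + e = e + 1 by omega) (show 2 + e = e + 2 by omega)
        (show 1 + (e + 1) = e + 2 by omega) a b y,
      W.contrOne_cup A hA φ (show 1 + e = e + 1 by omega) (show 1 + (e + 1) = e + 2 by omega) a,
      W.contrOne_cup A hA φ hc (show 1 + e = e + 1 by omega) b y,
      W.contrOne_cup A hA φ (Nat.add_zero 1) (rfl : 1 + 1 = 2) a b, W.contrOne_deg_one A hA,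
      LinearMap.map_smul, W.cup_one hA,
      W.cup_assoc hA (rfl : 1 + 1 = 2) (show 1 + c = c + 1 by omega) (show 2 + c = e + 1 by omega)
        (show 1 + (c + 1) = e + 1 by omega) a b]
    simp only [map_sub, map_smul, LinearMap.sub_apply, LinearMap.smul_apply]
    -- the term `a ∪ (b ∪ D_φ y)` occurs with two degree bookkeepings
    rw [W.cup_congr_right hc (show 1 + c = c + 1 by omega) (show 1 + e = e + 1 by omega)
      (show 1 + (c + 1) = e + 1 by omega) a b (W.contrOne A hA φ hc y)]
    abel
  | add t t' ht ht' =>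
    simp only [map_add, LinearMap.add_apply, ht, ht']
    abel

/-- **`D_φ(ηᵐ⁺¹) = (m + 1) D_φ(η) ∪ ηᵐ`** for a degree-two class `η` (Leibniz, `η` central).
[folklore] -/
theorem contrOne_pow (hA : IsSmoothProjective g A.X) (φ : Module.Dual K (W.obj A.X 1))
    (η₀ : W.obj A.X 2) (m : ℕ) :
    W.contrOne A hA φ (show 1 + (2 * m + 1) = 2 * (m + 1) by omega) (W.pow A.X η₀ (m + 1)) =
      ((m + 1 : ℕ) : K) • W.cup (show 1 + 2 * m = 2 * m + 1 by omega)
        (W.contrOne A hA φ (rfl : 1 + 1 = 2) η₀) (W.pow A.X η₀ m) := by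
  induction m with
  | zero =>
    rw [W.pow_succ, W.pow_zero, W.one_cup hA, W.cup_one hA]
    simp only [Nat.zero_add, Nat.cast_one, one_smul]
  | succ m ih =>
    rw [W.pow_succ A.X η₀ (m + 1),
      W.cup_comm_of_even hA (rfl : 2 * (m + 1) + 2 = 2 * (m + 1 + 1))
        (show 2 + 2 * (m + 1) = 2 * (m + 1 + 1) by omega) (Or.inr ⟨1, rfl⟩),
      W.contrOne_cup_deg_two A hA φ (show 1 + (2 * m + 1) = 2 * (m + 1) by omega) η₀, ih,
      LinearMap.map_smul]
    -- `η ∪ (Dη ∪ ηᵐ) = Dη ∪ ηᵐ⁺¹`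
    have hcomm : W.cup (show 2 + (2 * m + 1) = 2 * (m + 1) + 1 by omega) η₀
        (W.cup (show 1 + 2 * m = 2 * m + 1 by omega) (W.contrOne A hA φ (rfl : 1 + 1 = 2) η₀)
          (W.pow A.X η₀ m)) =
        W.cup (show 1 + 2 * (m + 1) = 2 * (m + 1) + 1 by omega)
          (W.contrOne A hA φ (rfl : 1 + 1 = 2) η₀) (W.pow A.X η₀ (m + 1)) := by
      rw [← W.cup_assoc hA (show 2 + 1 = 3 by omega) (show 1 + 2 * m = 2 * m + 1 by omega)
            (show 3 + 2 * m = 2 * (m + 1) + 1 by omega) (show 2 + (2 * m + 1) = 2 * (m + 1) + 1 by omega),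
        W.cup_comm_of_even hA (show 2 + 1 = 3 by omega) (show 1 + 2 = 3 by omega) (Or.inl ⟨1, rfl⟩),
        W.cup_assoc hA (show 1 + 2 = 3 by omega) (show 2 + 2 * m = 2 * (m + 1) by omega)
          (show 3 + 2 * m = 2 * (m + 1) + 1 by omega) (show 1 + 2 * (m + 1) = 2 * (m + 1) + 1 by omega),
        W.cup_comm_of_even hA (show 2 + 2 * m = 2 * (m + 1) by omega) (rfl : 2 * m + 2 = 2 * (m + 1))
          (Or.inl ⟨1, rfl⟩), ← W.pow_succ]
    rw [hcomm, show ((m + 1 + 1 : ℕ) : K) = 1 + ((m + 1 : ℕ) : K) by push_cast; ring, add_smul,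
      one_smul]

/-- The top product `m_{c+1}(b)` of a basis `b = (b₀, …, b_c)` of `H¹(A)` is nonzero:
`C_{b*}(m(b)) = det 1 = 1`. [folklore] -/
lemma prodMap_basis_ne_zero (hA : IsSmoothProjective g A.X) {n : ℕ}
    (b : Module.Basis (Fin n) K (W.obj A.X 1)) : W.prodMap A n b ≠ 0 := by
  intro h0
  have h := W.iterContr_prodMap A hA n b.coord b
  rw [h0, map_zero] at h
  have h1 : (Matrix.of fun i j ↦ b.coord i (b j)) = (1 : Matrix (Fin n) (Fin n) K) := by
    ext i j
    simp [Matrix.one_apply, Finsupp.single_apply, eq_comm]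
  rw [h1, Matrix.det_one] at h
  exact zero_ne_one h

/-- The products `m_c(b ∘ p.succAbove)` (one basis vector omitted) are linearly independent.
[folklore] -/
lemma linearIndependent_prodMap_succAbove (hA : IsSmoothProjective g A.X) {c : ℕ}
    (b : Module.Basis (Fin (c + 1)) K (W.obj A.X 1)) :
    LinearIndependent K (fun p : Fin (c + 1) ↦ W.prodMap A c (fun i ↦ b (p.succAbove i))) := by
  classical
  refine LinearIndependent.of_pairwise_dual_eq_zero_one _
    (fun q ↦ W.iterContr A hA c (fun i ↦ b.coord (q.succAbove i))) (fun q p hqp ↦ ?_) (fun p ↦ ?_)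
  · change W.iterContr A hA c (fun i ↦ b.coord (q.succAbove i)) (W.prodMap A c _) = 0
    rw [W.iterContr_prodMap A hA]
    obtain ⟨i₀, hi₀⟩ := Fin.exists_succAbove_eq (Ne.symm hqp)
    apply Matrix.det_eq_zero_of_row_eq_zero i₀
    intro j
    simp only [Matrix.of_apply, Module.Basis.coord_apply, Module.Basis.repr_self, hi₀]
    rw [Finsupp.single_eq_of_ne]
    exact (Fin.succAbove_ne p j).symm
  · change W.iterContr A hA c (fun i ↦ b.coord (p.succAbove i)) (W.prodMap A c _) = 1
    rw [W.iterContr_prodMap A hA]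
    have h1 : (Matrix.of fun i j ↦ b.coord (p.succAbove i) (b (p.succAbove j))) =
        (1 : Matrix (Fin c) (Fin c) K) := by
      ext i j
      simp [Matrix.one_apply, Finsupp.single_apply, eq_comm]
    rw [h1, Matrix.det_one]

/-- **`D_φ` is injective on the top degree**: for `φ ≠ 0` and `0 ≠ x ∈ Hᶜ⁺¹(A)`,
`c + 1 = 2g`, `D_φ x ≠ 0`. Indeed `Hᶜ⁺¹(A) = K · m(b)` for a basis `b = (b₀, …, b_c)` of `H¹(A)`
(`dim H¹ = 2g`, `dim H²ᵍ = 1`), and `D_φ(m(b)) = Σ_p ± φ(b_p) m(b ∘ p.succAbove)` with linearly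
independent products on the right. [folklore] -/
theorem contrOne_ne_zero_of_top (hA : IsSmoothProjective g A.X) {w : W.obj A.X 2}
    (hw : W.pow A.X w g ≠ 0) {c : ℕ} (hc : c + 1 = 2 * g) {φ : Module.Dual K (W.obj A.X 1)}
    (hφ : φ ≠ 0) {x : W.obj A.X (c + 1)} (hx : x ≠ 0) :
    W.contrOne A hA φ (Nat.add_comm 1 c) x ≠ 0 := by
  classical
  haveI := W.finite_obj hA 1
  haveI := W.finite_obj hA (c + 1)
  let b₀ := Module.finBasis K (W.obj A.X 1)
  have hvd : Module.finrank K (W.obj A.X 1) = c + 1 := by rw [W.eq_two_mul_dim A hA hw b₀]; omega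
  let b : Module.Basis (Fin (c + 1)) K (W.obj A.X 1) := b₀.reindex (finCongr hvd)
  -- `H^{c+1} = K · m(b)`
  have hx₀ : W.prodMap A (c + 1) b ≠ 0 := W.prodMap_basis_ne_zero A hA b
  have hdim : Module.finrank K (W.obj A.X (c + 1)) = 1 := by
    rw [W.finrank_eq_choose A hA hw b, Nat.choose_self]
  obtain ⟨κ, rfl⟩ := (finrank_eq_one_iff_of_nonzero' _ hx₀).mp hdim x
  have hκ : κ ≠ 0 := by rintro rfl; exact hx (zero_smul _ _)
  rw [map_smul, smul_ne_zero_iff, W.contrOne_prodMap A hA]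
  refine ⟨hκ, fun hsum ↦ hφ ?_⟩
  -- all coefficients vanish
  have hcoef := (Fintype.linearIndependent_iff.mp (W.linearIndependent_prodMap_succAbove A hA b)) _ hsum
  refine b.ext fun p ↦ ?_
  have hp := hcoef p
  rw [mul_eq_zero] at hp
  rcases hp with hp | hp
  · exact absurd hp (pow_ne_zero _ (neg_ne_zero.mpr one_ne_zero))
  · rw [hp, LinearMap.zero_apply]

/-- The **polarization map** `φ ↦ D_φ(η)` of a degree-two class `η`: `H¹(A)ᵛ → H¹(A)`
(contraction of the polarization tensor `Δ_{1,1} η`). [folklore] -/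
def polarization (hA : IsSmoothProjective g A.X) (η₀ : W.obj A.X 2) :
    Module.Dual K (W.obj A.X 1) →ₗ[K] W.obj A.X 1 where
  toFun φ := W.contrOne A hA φ (rfl : 1 + 1 = 2) η₀
  map_add' φ ψ := by rw [W.contrOne_add A hA, LinearMap.add_apply]
  map_smul' c φ := by rw [W.contrOne_smul A hA, LinearMap.smul_apply, RingHom.id_apply]

/-- `polarization η φ = D_φ η`. [folklore] -/
@[simp]
lemma polarization_apply (hA : IsSmoothProjective g A.X) (η₀ : W.obj A.X 2)
    (φ : Module.Dual K (W.obj A.X 1)) :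
    W.polarization A hA η₀ φ = W.contrOne A hA φ (rfl : 1 + 1 = 2) η₀ := rfl

/-- **The polarization map of a class with `ηᵍ ≠ 0` is injective** (hence bijective): if
`D_φ η = 0` then `D_φ(ηᵍ) = g D_φ(η) ∪ ηᵍ⁻¹ = 0`, while `D_φ` is injective on the top degree for
`φ ≠ 0` (nondegeneracy of the polarization; classically `K(L)` finite for `L` ample, Mumford §16).
[cite: MumfordAV1970, §16] -/
theorem polarization_injective (hA : IsSmoothProjective g A.X) {η₀ : W.obj A.X 2}
    (hη : W.pow A.X η₀ g ≠ 0) : Function.Injective (W.polarization A hA η₀) := by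
  rw [← LinearMap.ker_eq_bot, LinearMap.ker_eq_bot']
  intro φ hφ
  rw [polarization_apply] at hφ
  by_contra hne
  rcases Nat.eq_zero_or_pos g with hg | hg
  · -- `g = 0`: `H¹(A) = 0`, so `φ = 0`
    haveI := W.finite_obj hA 1
    let b₀ := Module.finBasis K (W.obj A.X 1)
    have hvd : Module.finrank K (W.obj A.X 1) = 0 := by rw [W.eq_two_mul_dim A hA hη b₀, hg]
    haveI : Subsingleton (W.obj A.X 1) := Module.finrank_zero_iff.mp hvd
    exact hne (LinearMap.ext fun v ↦ by rw [Subsingleton.elim v 0, map_zero, LinearMap.zero_apply])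
  · obtain ⟨g', rfl⟩ : ∃ g', g = g' + 1 := ⟨g - 1, by omega⟩
    have htop := W.contrOne_pow A hA φ η₀ g'
    rw [hφ, LinearMap.map_zero₂, smul_zero] at htop
    exact W.contrOne_ne_zero_of_top A hA hη (show 2 * g' + 1 + 1 = 2 * (g' + 1) by omega) hne hη htop

end Exterior

/-! ## The polarization class `ℓ = m*η - pr₁*η - pr₂*η` and the Fourier-type operators -/

section Fourier

open scoped MonObj

variable {g : ℕ} (A : AbelianVariety k)

/-! ### The polarization basis and the tensor `Δ_{1,1} η` -/

/-- Expansion of a tensor along a basis of the first factor: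
`t = Σ_a b_a ⊗ ((b*_a ⊗ id) t)`. [folklore] -/
lemma eq_sum_basis_tmul {n : ℕ} (b : Module.Basis (Fin n) K (W.obj A.X 1)) {M : Type*}
    [AddCommGroup M] [Module K M] (t : W.obj A.X 1 ⊗[K] M) :
    t = ∑ a : Fin n, b a ⊗ₜ TensorProduct.lid K M (LinearMap.rTensor M (b.coord a) t) := by
  induction t using TensorProduct.induction_on with
  | zero => simp
  | tmul v m =>
    simp only [LinearMap.rTensor_tmul, TensorProduct.lid_tmul, Module.Basis.coord_apply,
      TensorProduct.tmul_smul, TensorProduct.smul_tmul', ← TensorProduct.sum_tmul, b.sum_repr v]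
  | add t t' ht ht' =>
    conv_lhs => rw [ht, ht']
    rw [← Finset.sum_add_distrib]
    refine Finset.sum_congr rfl fun a _ ↦ ?_
    rw [map_add, map_add, TensorProduct.tmul_add]

/-- **The polarization basis** `y_a = D_{b*_a}(η)` of `H¹(A)` attached to a basis `b` and a class
`η` with `ηᵍ ≠ 0`: the image of the dual basis under the (bijective) polarization map. [folklore] -/
def polBasis (hA : IsSmoothProjective g A.X) {η₀ : W.obj A.X 2} (hη : W.pow A.X η₀ g ≠ 0) {n : ℕ}
    (b : Module.Basis (Fin n) K (W.obj A.X 1)) : Module.Basis (Fin n) K (W.obj A.X 1) :=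
  haveI := W.finite_obj hA 1
  b.dualBasis.map (LinearEquiv.ofBijective (W.polarization A hA η₀)
    ⟨W.polarization_injective A hA hη,
      (LinearMap.injective_iff_surjective_of_finrank_eq_finrank (Subspace.dual_finrank_eq)).mp
        (W.polarization_injective A hA hη)⟩)

/-- `y_a = D_{b*_a}(η)`. [folklore] -/
lemma polBasis_apply (hA : IsSmoothProjective g A.X) {η₀ : W.obj A.X 2} (hη : W.pow A.X η₀ g ≠ 0)
    {n : ℕ} (b : Module.Basis (Fin n) K (W.obj A.X 1)) (a : Fin n) :
    W.polBasis A hA hη b a = W.contrOne A hA (b.coord a) (rfl : 1 + 1 = 2) η₀ := by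
  simp [polBasis, Module.Basis.coe_dualBasis]

/-- **`Δ_{1,1} η = Σ_a b_a ⊗ y_a`**: the degree-`(1,1)` coproduct component of `η` in terms of a
basis and its polarization basis. [folklore] -/
theorem coprod_one_one_eq_sum (hA : IsSmoothProjective g A.X) {η₀ : W.obj A.X 2}
    (hη : W.pow A.X η₀ g ≠ 0) {n : ℕ} (b : Module.Basis (Fin n) K (W.obj A.X 1)) :
    W.coprod A hA 1 1 rfl η₀ = ∑ a : Fin n, b a ⊗ₜ W.polBasis A hA hη b a := by
  conv_lhs => rw [W.eq_sum_basis_tmul A b (W.coprod A hA 1 1 rfl η₀)]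
  refine Finset.sum_congr rfl fun a _ ↦ ?_
  rw [W.polBasis_apply A hA hη, contrOne_apply]

/-! ### The polarization class -/

/-- The **polarization class** `ℓ = ext(Δ_{1,1} η) ∈ H²(A × A)` of a degree-two class `η`
(the first Chern class of the Mumford bundle `m*L ⊗ pr₁*L⁻¹ ⊗ pr₂*L⁻¹`, cohomologically).
[cite: MumfordAV1970, §6 (Cor. 3 of the theorem of the cube) and §16] -/
def polClass (hA : IsSmoothProjective g A.X) (η₀ : W.obj A.X 2) : W.obj (A.X ⊗ A.X) 2 :=
  W.extTensor (rfl : 1 + 1 = 2) (W.coprod A hA 1 1 rfl η₀)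

/-- **`m* x = pr₁* x + pr₂* x + Σ_{a,b≥1} ext(Δ_{a,b} x)`** for a positive-degree class.
[cite: MumfordAV1970, §1] -/
theorem pullback_mu_eq_add (hA : IsSmoothProjective g A.X) {d : ℕ} (hd : d ≠ 0) (x : W.obj A.X d) :
    W.pullback μ[A.X] d x = W.pullback (fst A.X A.X) d x + W.pullback (snd A.X A.X) d x +
      ∑ ij ∈ (Finset.univ : Finset ↥(Finset.antidiagonal d)).filter
          (fun ij ↦ ij.1.1 ≠ 0 ∧ ij.1.2 ≠ 0),
        W.extTensor (Finset.mem_antidiagonal.mp ij.2)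
          (W.coprod A hA ij.1.1 ij.1.2 (Finset.mem_antidiagonal.mp ij.2) x) := by
  classical
  rw [← W.sum_extTensor_coprod A hA x,
    ← Finset.sum_filter_add_sum_filter_not Finset.univ
      (fun ij : ↥(Finset.antidiagonal d) ↦ ij.1.1 ≠ 0 ∧ ij.1.2 ≠ 0), add_comm]
  congr 1
  have hne : kIdx (Nat.add_zero d) ≠ kIdx (Nat.zero_add d) := by
    intro e
    have := congrArg (fun ij ↦ ij.1.1) e
    simp at this
    exact hd this
  rw [Finset.sum_eq_add (kIdx (Nat.add_zero d)) (kIdx (Nat.zero_add d)) hne]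
  · change W.extTensor (Nat.add_zero d) (W.coprod A hA d 0 (Nat.add_zero d) x) +
        W.extTensor (Nat.zero_add d) (W.coprod A hA 0 d (Nat.zero_add d) x) = _
    rw [W.coprod_self_zero A hA, W.coprod_zero_self A hA, extTensor_tmul, extTensor_tmul,
      ← W.pullback_fst_eq_externalCup hA hA, ← W.pullback_snd_eq_externalCup hA hA]
  · intro ij hij h2
    exfalso
    have h1 := Finset.mem_antidiagonal.mp ij.2
    rw [Finset.mem_filter] at hij
    rcases not_and_or.mp hij.2 with h3 | h3 <;> rw [not_ne_iff] at h3
    · exact h2.2 (Subtype.ext (Prod.ext h3 (by simp; omega)))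
    · exact h2.1 (Subtype.ext (Prod.ext (by simp; omega) h3))
  · intro h
    exfalso
    exact h (Finset.mem_filter.mpr ⟨Finset.mem_univ _, by simp⟩)
  · intro h
    exfalso
    exact h (Finset.mem_filter.mpr ⟨Finset.mem_univ _, by simp⟩)

/-- **`ℓ = m* η - pr₁* η - pr₂* η`** (in degree two the only middle bidegree is `(1, 1)`).
[cite: MumfordAV1970, §6 (Cor. 3 of the theorem of the cube)] -/
theorem polClass_eq (hA : IsSmoothProjective g A.X) (η₀ : W.obj A.X 2) :
    W.polClass A hA η₀ = W.pullback μ[A.X] 2 η₀ - W.pullback (fst A.X A.X) 2 η₀ -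
      W.pullback (snd A.X A.X) 2 η₀ := by
  classical
  rw [W.pullback_mu_eq_add A hA two_ne_zero]
  have hfil : (Finset.univ : Finset ↥(Finset.antidiagonal 2)).filter
      (fun ij ↦ ij.1.1 ≠ 0 ∧ ij.1.2 ≠ 0) = {kIdx (rfl : 1 + 1 = 2)} := by
    ext ij
    have h1 := Finset.mem_antidiagonal.mp ij.2
    simp only [Finset.mem_filter, Finset.mem_univ, true_and, Finset.mem_singleton]
    constructor
    · rintro ⟨ha, hb⟩
      exact Subtype.ext (Prod.ext (by simp; omega) (by simp; omega))
    · rintro rfl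
      simp
  rw [hfil, Finset.sum_singleton]
  change _ = _ + W.extTensor rfl (W.coprod A hA 1 1 rfl η₀) - _ - _
  rw [polClass]
  abel

/-- **The polarization class of an algebraic class is algebraic**: `ℓ ∈ A¹(A × A)_ℚ` for
`η ∈ A¹(A)_ℚ` (pull-backs along `m`, `pr₁`, `pr₂`). [folklore] -/
theorem polClass_mem_ratAlgebraicClasses (hA : IsSmoothProjective g A.X) {η₀ : W.obj A.X 2}
    (hη : η₀ ∈ W.ratAlgebraicClasses A.X 1) :
    W.polClass A hA η₀ ∈ W.ratAlgebraicClasses (A.X ⊗ A.X) 1 := by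
  have hAA := IsSmoothProjective.tensor_holds hA hA
  rw [W.polClass_eq A hA]
  refine sub_mem (sub_mem ?_ ?_) ?_ <;>
    exact W.pullback_ratAlgebraicClasses_le hAA hA _ 1 ⟨η₀, hη, rfl⟩

/-- `ℓ = Σ_a pr₁* b_a ∪ pr₂* y_a` along a basis and its polarization basis. [folklore] -/
theorem polClass_eq_sum (hA : IsSmoothProjective g A.X) {η₀ : W.obj A.X 2}
    (hη : W.pow A.X η₀ g ≠ 0) {n : ℕ} (b : Module.Basis (Fin n) K (W.obj A.X 1)) :
    W.polClass A hA η₀ = ∑ a : Fin n, W.externalCup A.X A.X (rfl : 1 + 1 = 2) (b a) (W.polBasis A hA hη b a) := by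
  rw [polClass, W.coprod_one_one_eq_sum A hA hη b, map_sum]
  simp

/-! ### Powers of the polarization class -/

/-- The signs `s₀ = 1`, `s_{i+1} = (-1)ⁱ sᵢ` (`sᵢ = (-1)^{i(i-1)/2}`) in the expansion of `ℓⁱ`.
[folklore] -/
def altSign : ℕ → ℤ
  | 0 => 1
  | i + 1 => (-1) ^ i * altSign i

/-- `s₀ = 1`. [folklore] -/
@[simp] lemma altSign_zero : altSign 0 = 1 := rfl

/-- `s_{i+1} = (-1)ⁱ sᵢ`. [folklore] -/
lemma altSign_succ (i : ℕ) : altSign (i + 1) = (-1) ^ i * altSign i := rfl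

/-- `sᵢ² = 1`. [folklore] -/
lemma altSign_mul_self (i : ℕ) : altSign i * altSign i = 1 := by
  induction i with
  | zero => rfl
  | succ i ih =>
    rw [altSign_succ]
    calc (-1) ^ i * altSign i * ((-1) ^ i * altSign i)
        = ((-1) ^ i * (-1) ^ i) * (altSign i * altSign i) := by ring
      _ = 1 := by rw [ih, ← pow_add, ← two_mul, pow_mul]; norm_num

omit [CharZero K] in
/-- The Koszul sign `(-1)^{1·i}` as a power of `-1` in `K`. [folklore] -/
lemma negOnePow_natCast_smul [CharZero K] {M : Type*} [AddCommGroup M] [Module K M] (i : ℕ) (v : M) :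
    ((((i : ℕ) : ℤ)).negOnePow : ℤ) • v = ((-1 : K) ^ i) • v := by
  induction i with
  | zero => simp
  | succ i ih =>
    rw [Nat.cast_succ, Int.negOnePow_succ, Units.val_neg, neg_smul, ih, pow_succ, mul_neg_one,
      neg_smul]

/-- `b ∘ cons a c = cons (b a) (b ∘ c)` as functions on `Fin (i + 1)`. [folklore] -/
lemma comp_cons_eq {n i : ℕ} {M : Type*} (b : Fin n → M) (a : Fin n) (c : Fin i → Fin n) :
    (fun p : Fin (i + 1) ↦ b ((Fin.cons a c : Fin (i + 1) → Fin n) p)) =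
      Fin.cons (b a) (fun p ↦ b (c p)) := by
  funext p
  cases p using Fin.cases with
  | zero => simp
  | succ q => simp

/-- Reindexing a sum over `(i+1)`-tuples by the first entry and the tail. [folklore] -/
lemma sum_sum_cons {M : Type*} [AddCommMonoid M] {i n : ℕ} (G : (Fin (i + 1) → Fin n) → M) :
    ∑ a : Fin n, ∑ c : Fin i → Fin n, G (Fin.cons a c) = ∑ c', G c' := by
  rw [← Fintype.sum_prod_type' (fun (a : Fin n) (c : Fin i → Fin n) ↦ G (Fin.cons a c))]
  exact Fintype.sum_equiv (Fin.consEquiv fun _ ↦ Fin n) _ _ (fun q ↦ rfl)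

/-- **Expansion of the powers of the polarization class**:
`ℓⁱ = sᵢ Σ_{c : Fin i → Fin n} pr₁* m_i(b ∘ c) ∪ pr₂* m_i(y ∘ c)` for a basis `b` of `H¹(A)` with
polarization basis `y` (`ℓ = Σ_a pr₁* b_a ∪ pr₂* y_a` and the Koszul rule on `A × A`). [folklore] -/
theorem pow_polClass_eq_sum (hA : IsSmoothProjective g A.X) {η₀ : W.obj A.X 2}
    (hη : W.pow A.X η₀ g ≠ 0) {n : ℕ} (b : Module.Basis (Fin n) K (W.obj A.X 1)) (i : ℕ) :
    W.pow (A.X ⊗ A.X) (W.polClass A hA η₀) i =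
      ((altSign i : ℤ) : K) • ∑ c : Fin i → Fin n, W.extTensor (two_mul i).symm
        (W.prodMap A i (fun p ↦ b (c p)) ⊗ₜ W.prodMap A i (fun p ↦ W.polBasis A hA hη b (c p))) := by
  have hAA := IsSmoothProjective.tensor_holds hA hA
  induction i with
  | zero =>
    rw [W.pow_zero, altSign_zero, Int.cast_one, one_smul, Fintype.sum_unique]
    simp only [prodMap_zero, extTensor_tmul, externalCup_apply, W.map_one hAA hA, W.one_cup hAA]
  | succ i ih =>
    rw [W.pow_succ, ih, W.polClass_eq_sum A hA hη b,
      W.cup_comm_of_even hAA (rfl : 2 * i + 2 = 2 * (i + 1))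
        (show 2 + 2 * i = 2 * (i + 1) by omega) (Or.inr ⟨1, rfl⟩),
      LinearMap.map_sum₂, ]
    -- expand each `ext(b_a ⊗ y_a) ∪ (sᵢ Σ_c ext(x_c ⊗ y_c))`
    have hterm : ∀ a : Fin n, W.cup (show 2 + 2 * i = 2 * (i + 1) by omega)
        (W.externalCup A.X A.X (rfl : 1 + 1 = 2) (b a) (W.polBasis A hA hη b a))
        (((altSign i : ℤ) : K) • ∑ c : Fin i → Fin n, W.extTensor (two_mul i).symm
          (W.prodMap A i (fun p ↦ b (c p)) ⊗ₜ W.prodMap A i (fun p ↦ W.polBasis A hA hη b (c p)))) =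
        (((altSign i : ℤ) : K) * (-1 : K) ^ i) • ∑ c : Fin i → Fin n,
          W.extTensor (two_mul (i + 1)).symm
            (W.prodMap A (i + 1) (fun p ↦ b ((Fin.cons a c : Fin (i + 1) → Fin n) p)) ⊗ₜ
              W.prodMap A (i + 1)
                (fun p ↦ W.polBasis A hA hη b ((Fin.cons a c : Fin (i + 1) → Fin n) p))) := by
      intro a
      rw [LinearMap.map_smul]
      simp only [map_sum, mul_smul, Finset.smul_sum]
      refine Finset.sum_congr rfl fun c _ ↦ ?_
      rw [← extTensor_tmul, W.cup_extTensor_extTensor hA hA (rfl : 1 + 1 = 2) (two_mul i).symm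
        (show 2 + 2 * i = 2 * (i + 1) by omega) (Nat.add_comm 1 i) (Nat.add_comm 1 i)
        (two_mul (i + 1)).symm, tensorCup_tmul, W.cup_prodMap A, W.cup_prodMap A, Nat.cast_one,
        one_mul, negOnePow_natCast_smul (K := K), comp_cons_eq, comp_cons_eq]
    rw [Finset.sum_congr rfl fun a _ ↦ hterm a, ← Finset.smul_sum, altSign_succ, Int.cast_mul,
      Int.cast_pow, Int.cast_neg, Int.cast_one, mul_comm ((-1 : K) ^ i)]
    congr 1
    -- `Σ_a Σ_c F(cons a c) = Σ_{c'} F(c')`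
    symm
    exact (sum_sum_cons _).symm

/-! ### The Fourier-type operators `Hʲ(A) → Hⁱ(A)`, `j + i = 2g` -/

/-- The **Fourier-type operator** `F(z) = Σ_c tr(z ∪ m_i(b ∘ c)) m_i(y ∘ c) : Hʲ(A) → Hⁱ(A)`
(`j + i = 2g`), the map induced by the algebraic correspondence `sᵢ ℓⁱ ∈ Aⁱ(A × A)_ℚ`
(cohomological Fourier transform with kernel `ℓⁱ/i!`, up to a rational factor). [folklore] -/
def fourierOp (hA : IsSmoothProjective g A.X) {η₀ : W.obj A.X 2} (hη : W.pow A.X η₀ g ≠ 0) {n : ℕ}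
    (b : Module.Basis (Fin n) K (W.obj A.X 1)) {i j : ℕ} (hij : j + i = 2 * g) :
    W.obj A.X j →ₗ[K] W.obj A.X i :=
  ∑ c : Fin i → Fin n, ((W.cupPairing A.X g j i hij).flip (W.prodMap A i (fun p ↦ b (c p)))).smulRight
    (W.prodMap A i (fun p ↦ W.polBasis A hA hη b (c p)))

/-- `F(z) = Σ_c tr(z ∪ x_c) • y_c`. [folklore] -/
lemma fourierOp_apply (hA : IsSmoothProjective g A.X) {η₀ : W.obj A.X 2} (hη : W.pow A.X η₀ g ≠ 0)
    {n : ℕ} (b : Module.Basis (Fin n) K (W.obj A.X 1)) {i j : ℕ} (hij : j + i = 2 * g)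
    (z : W.obj A.X j) :
    W.fourierOp A hA hη b hij z = ∑ c : Fin i → Fin n,
      W.trace A.X g (W.cup hij z (W.prodMap A i (fun p ↦ b (c p)))) •
        W.prodMap A i (fun p ↦ W.polBasis A hA hη b (c p)) := by
  simp [fourierOp, LinearMap.sum_apply]

/-- The correspondence `Σ_c pr₁* x_c ∪ pr₂* y_c` induces the Fourier-type operator, in
Kleiman's pairing form. [folklore] -/
lemma isInducedBy_fourierOp (hA : IsSmoothProjective g A.X) {η₀ : W.obj A.X 2}
    (hη : W.pow A.X η₀ g ≠ 0) {n : ℕ} (b : Module.Basis (Fin n) K (W.obj A.X 1)) {i j : ℕ}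
    (hij : j + i = 2 * g) {c j'' : ℕ} (h : i + i = 2 * c) (hj : i + j'' = 2 * g)
    (hm : j + 2 * c + j'' = 2 * (g + g)) :
    W.IsInducedBy g g (∑ c' : Fin i → Fin n, W.extTensor h
        (W.prodMap A i (fun p ↦ b (c' p)) ⊗ₜ W.prodMap A i (fun p ↦ W.polBasis A hA hη b (c' p))))
      (W.fourierOp A hA hη b hij) hj hm := by
  intro z w
  rw [W.fourierOp_apply A hA hη b hij]
  simp only [map_sum, LinearMap.sum_apply, map_smul, LinearMap.smul_apply, smul_eq_mul,
    extTensor_tmul]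
  refine Finset.sum_congr rfl fun c' _ ↦ ?_
  rw [W.trace_cup_cup_externalCup_of_eq hA hA h hm hij hj]

/-- **The Fourier-type operator is algebraic**: it is induced by `Σ_c pr₁* x_c ∪ pr₂* y_c = sᵢ ℓⁱ`,
a rational algebraic class when `η ∈ A¹(A)_ℚ`, and vanishes in all other bidegrees. [folklore] -/
theorem isAlgebraicOperator_fourierOp (hA : IsSmoothProjective g A.X) {η₀ : W.obj A.X 2}
    (hη : W.pow A.X η₀ g ≠ 0) (hηalg : η₀ ∈ W.ratAlgebraicClasses A.X 1) {n : ℕ}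
    (b : Module.Basis (Fin n) K (W.obj A.X 1)) {i j : ℕ} (hij : j + i = 2 * g) :
    W.IsAlgebraicOperator g g (W.fourierOp A hA hη b hij) := by
  have hAA := IsSmoothProjective.tensor_holds hA hA
  -- the classes
  let U : (c : ℕ) → i + i = 2 * c → W.obj (A.X ⊗ A.X) (2 * c) := fun c h ↦
    ∑ c' : Fin i → Fin n, W.extTensor h
      (W.prodMap A i (fun p ↦ b (c' p)) ⊗ₜ W.prodMap A i (fun p ↦ W.polBasis A hA hη b (c' p)))
  have hU : ∀ (c : ℕ) (h : i + i = 2 * c), U c h ∈ W.ratAlgebraicClasses (A.X ⊗ A.X) c := by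
    intro c h
    have hci : c = i := by omega
    subst c
    have hpow := W.pow_polClass_eq_sum A hA hη b i
    have : U i h = (altSign i : ℤ) • W.pow (A.X ⊗ A.X) (W.polClass A hA η₀) i := by
      rw [hpow, ← Int.cast_smul_eq_zsmul K, smul_smul, ← Int.cast_mul, altSign_mul_self,
        Int.cast_one, one_smul]
    rw [this]
    exact AddSubgroup.zsmul_mem _ (W.pow_mem_ratAlgebraicClasses hAA
      (W.polClass_mem_ratAlgebraicClasses A hA hηalg) i) _
  refine ⟨fun c ↦ ⟨if h : i + i = 2 * c then U c h else 0, ?_⟩, ?_, ?_⟩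
  · show (if h : i + i = 2 * c then U c h else 0) ∈ _
    split_ifs with h
    · exact hU c h
    · exact zero_mem _
  · intro i' j' c j'' hj' hm' hc
    dsimp only
    by_cases h : i + i = 2 * c
    · rw [dif_pos h]
      by_cases hcomp : j = i' ∧ i = j'
      · obtain ⟨hc1, hc2⟩ := hcomp
        subst i' j'
        rw [PreWeilCohomology.GradedOp.ofLinearMap_apply_same]
        exact W.isInducedBy_fourierOp A hA hη b hij h hj' hm'
      · rw [PreWeilCohomology.GradedOp.ofLinearMap_apply_of_ne _ hcomp]
        intro z w
        simp only [U, LinearMap.zero_apply, map_zero, map_sum, LinearMap.sum_apply, extTensor_tmul]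
        symm
        refine Finset.sum_eq_zero fun c' _ ↦ ?_
        exact W.trace_cup_cup_externalCup_of_ne hA hA h hm' (by omega) _ _ _ _
    · rw [dif_neg h, PreWeilCohomology.GradedOp.ofLinearMap_apply_of_ne]
      · exact W.isInducedBy_zero
      · rintro ⟨rfl, rfl⟩
        exact h (by omega)
  · intro i' j' hne
    apply PreWeilCohomology.GradedOp.ofLinearMap_apply_of_ne
    rintro ⟨rfl, rfl⟩
    exact hne ⟨i, by omega⟩

/-! ### Injectivity of the Fourier-type operators -/

open Set.powersetCard in
/-- **Regrouping a symmetric sum over tuples by their image**: if `F(c) = 0` for non-injective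
`c : Fin i → Fin n` and `F(c ∘ σ) = F(c)` for all permutations `σ`, then
`Σ_c F(c) = Σ_s N_s F(e_s)` over the `i`-element subsets `s` (increasing enumeration `e_s`), with
positive multiplicities `N_s` (the number of enumerations of `s`). [folklore] -/
lemma exists_sum_eq_sum_powersetCard {M : Type*} [AddCommMonoid M] {i n : ℕ}
    (F : (Fin i → Fin n) → M) (h0 : ∀ c, ¬ Function.Injective c → F c = 0)
    (hperm : ∀ (c : Fin i → Fin n) (σ : Equiv.Perm (Fin i)), F (c ∘ σ) = F c) :
    ∃ N : Set.powersetCard (Fin n) i → ℕ, (∀ s, N s ≠ 0) ∧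
      ∑ c, F c = ∑ s : Set.powersetCard (Fin n) i, N s • F (ofFinEmbEquiv.symm s) := by
  classical
  let fib : Set.powersetCard (Fin n) i → Finset (Fin i → Fin n) := fun s ↦
    Finset.univ.filter (fun c ↦ Function.Injective c ∧ Finset.univ.image c = s.val)
  -- every member of the fibre of `s` is a re-enumeration of `s`
  have hconst : ∀ (s : Set.powersetCard (Fin n) i), ∀ c ∈ fib s, F c = F (ofFinEmbEquiv.symm s) := by
    intro s c hc
    simp only [fib, Finset.mem_filter, Finset.mem_univ, true_and] at hc
    obtain ⟨hinj, himg⟩ := hc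
    have hmem : ∀ q, c q ∈ s.val := fun q ↦ by
      rw [← himg]; exact Finset.mem_image_of_mem c (Finset.mem_univ q)
    let iso := s.val.orderIsoOfFin s.prop
    let τ : Fin i → Fin i := fun q ↦ iso.symm ⟨c q, hmem q⟩
    have hτ : ∀ q, (ofFinEmbEquiv.symm s) (τ q) = c q := by
      intro q
      rw [ofFinEmbEquiv_symm_apply, ← Finset.coe_orderIsoOfFin_apply]
      simp [τ, iso]
    have hτinj : Function.Injective τ := by
      intro q q' hqq'
      apply hinj
      rw [← hτ q, ← hτ q', hqq']
    let σ : Equiv.Perm (Fin i) := Equiv.ofBijective τ (Finite.injective_iff_bijective.mp hτinj)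
    have hc : c = (ofFinEmbEquiv.symm s) ∘ σ := by
      funext q
      exact (hτ q).symm
    rw [hc, hperm]
  refine ⟨fun s ↦ (fib s).card, fun s ↦ ?_, ?_⟩
  · apply Finset.card_ne_zero_of_mem (a := (ofFinEmbEquiv.symm s : Fin i → Fin n))
    simp only [fib, Finset.mem_filter, Finset.mem_univ, true_and]
    refine ⟨(ofFinEmbEquiv.symm s).injective, ?_⟩
    ext x
    simp only [Finset.mem_image, Finset.mem_univ, true_and]
    rw [Set.powersetCard.mem_coe_iff, ← mem_range_ofFinEmbEquiv_symm_iff_mem, Set.mem_range]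
  · have h1 : ∑ c, F c = ∑ c ∈ Finset.univ.filter (fun c : Fin i → Fin n ↦ Function.Injective c), F c := by
      rw [Finset.sum_filter_of_ne]
      intro c _ hc
      by_contra hinj
      exact hc (h0 c hinj)
    have hmaps : ∀ c ∈ Finset.univ.filter (fun c : Fin i → Fin n ↦ Function.Injective c),
        Finset.univ.image c ∈ Finset.powersetCard i (Finset.univ : Finset (Fin n)) := by
      intro c hc
      rw [Finset.mem_powersetCard]
      exact ⟨Finset.subset_univ _, by
        rw [Finset.card_image_of_injective _ (Finset.mem_filter.mp hc).2, Finset.card_univ,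
          Fintype.card_fin]⟩
    rw [h1, ← Finset.sum_fiberwise_of_maps_to hmaps,
      Finset.sum_subtype (Finset.powersetCard i (Finset.univ : Finset (Fin n)))
        (p := fun t ↦ t ∈ Set.powersetCard (Fin n) i)
        (fun t ↦ by rw [Finset.mem_powersetCard, Set.powersetCard.mem_iff]; simp)]
    refine Finset.sum_congr rfl fun s _ ↦ ?_
    have hfib : (Finset.univ.filter (fun c : Fin i → Fin n ↦ Function.Injective c)).filter
        (fun c ↦ Finset.univ.image c = s.val) = fib s := by
      ext c
      simp [fib, Finset.mem_filter]
    rw [hfib, Finset.sum_congr rfl (hconst s), Finset.sum_const]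

open Set.powersetCard in
/-- **The Fourier-type operator is injective.** Regrouping `F(z) = Σ_c tr(z ∪ x_c) y_c` by the
images of the tuples `c` (the products are alternating) gives `Σ_s N_s tr(z ∪ x_s) y_s` with
`N_s ≠ 0`; the `y_s` form a basis of `Hⁱ(A)`, so `tr(z ∪ x_s) = 0` for all `s`, and the `x_s`
form a basis of `Hⁱ(A)`, so `z = 0` by Poincaré duality. [folklore] -/
theorem fourierOp_injective (hA : IsSmoothProjective g A.X) {η₀ : W.obj A.X 2}
    (hη : W.pow A.X η₀ g ≠ 0) {n : ℕ} (b : Module.Basis (Fin n) K (W.obj A.X 1)) {i j : ℕ}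
    (hij : j + i = 2 * g) : Function.Injective (W.fourierOp A hA hη b hij) := by
  classical
  rw [← LinearMap.ker_eq_bot, LinearMap.ker_eq_bot']
  intro z hz
  let y := W.polBasis A hA hη b
  -- regroup
  let F : (Fin i → Fin n) → W.obj A.X i := fun c ↦
    W.trace A.X g (W.cup hij z (W.prodMap A i (fun p ↦ b (c p)))) • W.prodMap A i (fun p ↦ y (c p))
  have h0 : ∀ c, ¬ Function.Injective c → F c = 0 := by
    intro c hc
    have : W.prodMap A i (fun p ↦ b (c p)) = 0 := by
      rw [← prodAlt_apply (hA := hA)]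
      exact (W.prodAlt A hA i).map_eq_zero_of_not_injective _ fun h ↦
        hc (Function.Injective.of_comp (f := b) h)
    simp only [F]
    rw [this, LinearMap.map_zero, map_zero, zero_smul]
  have hperm : ∀ (c : Fin i → Fin n) (σ : Equiv.Perm (Fin i)), F (c ∘ σ) = F c := by
    intro c σ
    have hx : W.prodMap A i (fun p ↦ b ((c ∘ σ) p)) =
        Equiv.Perm.sign σ • W.prodMap A i (fun p ↦ b (c p)) := by
      rw [← prodAlt_apply (hA := hA), ← prodAlt_apply (hA := hA)]
      exact (W.prodAlt A hA i).map_perm (fun p ↦ b (c p)) σ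
    have hy : W.prodMap A i (fun p ↦ y ((c ∘ σ) p)) =
        Equiv.Perm.sign σ • W.prodMap A i (fun p ↦ y (c p)) := by
      rw [← prodAlt_apply (hA := hA), ← prodAlt_apply (hA := hA)]
      exact (W.prodAlt A hA i).map_perm (fun p ↦ y (c p)) σ
    simp only [F]
    rw [hx, hy, Units.smul_def, Units.smul_def, LinearMap.map_smul_of_tower, map_zsmul, smul_assoc,
      smul_comm _ ((Equiv.Perm.sign σ : ℤ)), ← mul_smul, ← Units.val_mul, Int.units_mul_self,
      Units.val_one, one_smul]
  obtain ⟨N, hN, hsum⟩ := exists_sum_eq_sum_powersetCard F h0 hperm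
  simp only [F] at hsum
  rw [W.fourierOp_apply A hA hη b hij, hsum] at hz
  -- coefficients vanish
  have hli := W.linearIndependent_prodFamily A hA y i
  have hz' : ∑ s : Set.powersetCard (Fin n) i,
      ((N s : K) * W.trace A.X g (W.cup hij z (W.prodFamily A b i s))) • W.prodFamily A y i s = 0 := by
    rw [← hz]
    refine Finset.sum_congr rfl fun s _ ↦ ?_
    rw [mul_smul, Nat.cast_smul_eq_nsmul]
    rfl
  have hcoef := Fintype.linearIndependent_iff.mp hli _ hz'
  have key : ∀ s : Set.powersetCard (Fin n) i, W.trace A.X g (W.cup hij z (W.prodFamily A b i s)) = 0 :=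
    fun s ↦ (mul_eq_zero.mp (hcoef s)).resolve_left (Nat.cast_ne_zero.mpr (hN s))
  -- Poincaré duality
  haveI := W.isPerfPair_cupPairing hA j i hij
  apply (LinearMap.IsPerfPair.bijective_left (W.cupPairing A.X g j i hij)).1
  rw [map_zero]
  refine (W.prodBasis A hA hη b i).ext fun s ↦ ?_
  rw [LinearMap.zero_apply, cupPairing_apply, W.prodBasis_apply A hA hη]
  exact key s

/-- **The Fourier-type operator `Hʲ(A) → Hⁱ(A)` (`j + i = 2g`) is an algebraic isomorphism.**
[folklore] -/
theorem fourierOp_bijective (hA : IsSmoothProjective g A.X) {η₀ : W.obj A.X 2}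
    (hη : W.pow A.X η₀ g ≠ 0) {n : ℕ} (b : Module.Basis (Fin n) K (W.obj A.X 1)) {i j : ℕ}
    (hij : j + i = 2 * g) : Function.Bijective (W.fourierOp A hA hη b hij) := by
  haveI := W.finite_obj hA j
  haveI := W.finite_obj hA i
  exact ⟨W.fourierOp_injective A hA hη b hij,
    (LinearMap.injective_iff_surjective_of_finrank_eq_finrank (W.finrank_obj_eq_of_add_eq hA hij)).mp
      (W.fourierOp_injective A hA hη b hij)⟩

end Fourier

end WeilCohomology

end Literature.AlgebraicGeometry.Motives

end
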